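import Literature.Probability.RandomPlanarGeometry.HexParafermionModes
import Literature.Probability.RandomPlanarGeometry.HexParafermionSpinShift
import Literature.Probability.LatticeModels.HexStarDirections
import HarnessLib

/-!
# The mode identities of the SAW parafermionic observable at a vertex

Topic `Literature/Probability/RandomPlanarGeometry`; continuation of `HexParafermionModes.lean` (the three parts
`A` = first arrivals, `L` = loop arrivals, `D` = departures of `F(a, {v,t}, x_c, 5/8)`, transported to the
coordinate model) and `HexSAWModes.lean` (in the coordinate model the departures from `v` are the two one-step
prolongations of the first arrivals, with weights `x_c λ^{∓1}`). Source: H. Duminil-Copin, S. Smirnov, Ann. of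
Math. 175 (2012), 1653–1665 (arXiv:1007.0575), §2, proof of Lemma 1 ("grouped in triplets").

* **`departure_sum_eq`** (sum mode): for `a ∈ ∂Ω`, `v ∈ V(Ω)` with neighbours `p, q, r`, at `x_c`, `σ = 5/8`,
  `D_p + D_q + D_r = x_c (λ + λ⁻¹) (A_p + A_q + A_r)` (`λ + λ⁻¹ = 2cos(5π/24)`, `HV.lam_add_lam_inv`), hence
  `F_p + F_q + F_r = (1 + 2x_c cos(5π/24))·ΣA + ΣL` (`observable_sum_eq`; coefficient `1.8587…`);
* **`departure_twist_eq`** (conjugate-direction mode, weights `(mid_t - v)⁻¹`):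
  `Σ_t (mid_t - v)⁻¹ D_t = x_c (λ⁻¹⁷ - λ⁻⁷) Σ_t (mid_t - v)⁻¹ A_t` (`λ⁻¹⁷ - λ⁻⁷ = 2cos(11π/24)`, `HV.lam_B`),
  hence `Σ_t (mid_t - v)⁻¹ F_t = (1 + 2x_c cos(11π/24)) Σ_t (mid_t - v)⁻¹ A_t + Σ_t (mid_t - v)⁻¹ L_t`
  (`observable_twist_eq`; coefficient `1.1413…`).

With the clockwise labelling `w₀, w₁, w₂` of the neighbours, `(mid_{w_j} - v)⁻¹ = ρ⁻¹ e^{-iθ₀} ω^j`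
(`ω = e^{2πi/3}`, `ρ = |mid - v|`), so `Σ_t (mid_t - v)⁻¹ F_t` is `ρ⁻¹ e^{-iθ₀}` times the combination
`F₀ + ωF₁ + ω²F₂` whose smallness relative to `F₀ + F₁ + F₂` at deep vertices is the lattice form of DCS's
conjectured orientation-independence of the scaling limit (p. 7). The identities say that both combinations
are FIXED multiples of the same combinations of the first arrivals, up to the loop walks; with the direction
weights `(mid_t - v)` themselves the coefficient is `1 + x_c(ω²λ⁻¹ - ωλ) = 0` (`HV.triplet_identity`) and the
loop part cancels in pairs in a simply connected domain — that is Lemma 1. No simple connectivity is needed here.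
-/

noncomputable section

open Finset Literature.Probability.LatticeModels Literature.Probability.Percolation

namespace Literature.Probability.RandomPlanarGeometry.SAW

/-! ### The mode identities in the language of the observable -/

section Modes

open HV

variable {Λ : Finset HexVertex} {a : Sym2 HexVertex} {v p q r : HexVertex}

/-- **Sum mode: departures are `x_c (λ + λ⁻¹)` times first arrivals.** For a boundary mid-edge `a` of the
domain with vertex set `Λ`, a vertex `v ∈ Λ` and its three neighbours `p, q, r`, at `x = x_c`, `σ = 5/8`:
`D_p + D_q + D_r = x_c (λ + λ⁻¹) (A_p + A_q + A_r)` (`λ + λ⁻¹ = 2cos(5π/24)`, `HV.lam_add_lam_inv`).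
[cite: DuminilCopinSmirnov2012, proof of Lemma 1 (grouping in triplets)] -/
theorem departure_sum_eq (ha : a ∈ hexDomainBoundary Λ) (hv : v ∈ Λ) (hp : hexGraph.Adj v p)
    (hq : hexGraph.Adj v q) (hr : hexGraph.Adj v r) (hpq : p ≠ q) (hqr : q ≠ r) (hpr : p ≠ r) :
    departureObservable Λ a hexCriticalFugacity (5 / 8) v p +
        departureObservable Λ a hexCriticalFugacity (5 / 8) v q +
          departureObservable Λ a hexCriticalFugacity (5 / 8) v r =
      (hexCriticalFugacity : ℂ) * (lam + lam ^ (-1 : ℤ)) *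
        (firstArrivalObservable Λ a hexCriticalFugacity (5 / 8) v p +
          firstArrivalObservable Λ a hexCriticalFugacity (5 / 8) v q +
            firstArrivalObservable Λ a hexCriticalFugacity (5 / 8) v r) := by
  classical
  obtain ⟨haE, u, w₁, rfl, hw₁, hu⟩ := ha
  have huw : hexGraph.Adj u w₁ := (SimpleGraph.mem_edgeSet hexGraph).1 haE
  obtain ⟨Φ, α, β, hα, hΦu, hΦw, haff⟩ := exists_chart huw
  set V := Λ.map Φ.toEquiv.toEmbedding with hV
  have hw : wOut ∉ V := by
    intro h
    obtain ⟨y, hy, hyu⟩ := Finset.mem_map.1 h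
    change Φ y = wOut at hyu
    exact hu (Φ.injective (hyu.trans hΦu.symm) ▸ hy)
  have hvV : Φ v ∈ V := Finset.mem_map_of_mem _ hv
  have hp' : hvGraph.Adj (Φ v) (Φ p) := (Φ.map_rel_iff).2 hp
  have hq' : hvGraph.Adj (Φ v) (Φ q) := (Φ.map_rel_iff).2 hq
  have hr' : hvGraph.Adj (Φ v) (Φ r) := (Φ.map_rel_iff).2 hr
  have key := sum_clsOut_pwt hw hvV
  rw [← sum_congr rfl fun P _ => one_mul (pwt P), sum_split_three (π := fun P => (finalDart P).2)
    (fun _ => (1 : ℂ)) hp' hq' hr' (Φ.injective.ne hpq) (Φ.injective.ne hqr) (Φ.injective.ne hpr)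
    (fun P hP => adj_of_mem_clsOut hP)] at key
  conv_rhs at key => rw [← sum_congr rfl fun P _ => one_mul (pwt P),
    sum_split_three (π := fun P => (finalDart P).1) (fun _ => (1 : ℂ)) hp' hq' hr'
      (Φ.injective.ne hpq) (Φ.injective.ne hqr) (Φ.injective.ne hpr) (fun P hP => adj_of_mem_clsIn hP)]
  rw [departureObservable_eq rfl hu hw₁ huw hΦu hΦw haff hα hp hv,
    departureObservable_eq rfl hu hw₁ huw hΦu hΦw haff hα hq hv,
    departureObservable_eq rfl hu hw₁ huw hΦu hΦw haff hα hr hv,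
    firstArrivalObservable_eq rfl hu hw₁ huw hΦu hΦw haff hα hp hv,
    firstArrivalObservable_eq rfl hu hw₁ huw hΦu hΦw haff hα hq hv,
    firstArrivalObservable_eq rfl hu hw₁ huw hΦu hΦw haff hα hr hv]
  simp only [one_mul] at key
  exact key

/-- **Beltrami mode: with the conjugate-direction weights `(mid_t - v)⁻¹`, departures are
`x_c (λ⁻¹⁷ - λ⁻⁷)` times first arrivals** (`λ⁻¹⁷ - λ⁻⁷ = 2cos(11π/24)`, `HV.lam_B`).
[cite: DuminilCopinSmirnov2012, proof of Lemma 1 (grouping in triplets)] -/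
theorem departure_twist_eq (ha : a ∈ hexDomainBoundary Λ) (hv : v ∈ Λ) (hp : hexGraph.Adj v p)
    (hq : hexGraph.Adj v q) (hr : hexGraph.Adj v r) (hpq : p ≠ q) (hqr : q ≠ r) (hpr : p ≠ r) :
    (hexMidpoint s(v, p) - hexCenter v)⁻¹ * departureObservable Λ a hexCriticalFugacity (5 / 8) v p +
        (hexMidpoint s(v, q) - hexCenter v)⁻¹ * departureObservable Λ a hexCriticalFugacity (5 / 8) v q +
          (hexMidpoint s(v, r) - hexCenter v)⁻¹ * departureObservable Λ a hexCriticalFugacity (5 / 8) v r =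
      (hexCriticalFugacity : ℂ) * (lam ^ (-17 : ℤ) - lam ^ (-7 : ℤ)) *
        ((hexMidpoint s(v, p) - hexCenter v)⁻¹ * firstArrivalObservable Λ a hexCriticalFugacity (5 / 8) v p +
          (hexMidpoint s(v, q) - hexCenter v)⁻¹ * firstArrivalObservable Λ a hexCriticalFugacity (5 / 8) v q +
            (hexMidpoint s(v, r) - hexCenter v)⁻¹ *
              firstArrivalObservable Λ a hexCriticalFugacity (5 / 8) v r) := by
  classical
  obtain ⟨haE, u, w₁, rfl, hw₁, hu⟩ := ha
  have huw : hexGraph.Adj u w₁ := (SimpleGraph.mem_edgeSet hexGraph).1 haE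
  obtain ⟨Φ, α, β, hα, hΦu, hΦw, haff⟩ := exists_chart huw
  set V := Λ.map Φ.toEquiv.toEmbedding with hV
  have hw : wOut ∉ V := by
    intro h
    obtain ⟨y, hy, hyu⟩ := Finset.mem_map.1 h
    change Φ y = wOut at hyu
    exact hu (Φ.injective (hyu.trans hΦu.symm) ▸ hy)
  have hvV : Φ v ∈ V := Finset.mem_map_of_mem _ hv
  have hp' : hvGraph.Adj (Φ v) (Φ p) := (Φ.map_rel_iff).2 hp
  have hq' : hvGraph.Adj (Φ v) (Φ q) := (Φ.map_rel_iff).2 hq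
  have hr' : hvGraph.Adj (Φ v) (Φ r) := (Φ.map_rel_iff).2 hr
  have key := sum_clsOut_inv_edir_pwt hw hvV
  rw [sum_split_three (π := fun P => (finalDart P).2) (fun y => (edir (Φ v) y)⁻¹) hp' hq' hr'
    (Φ.injective.ne hpq) (Φ.injective.ne hqr) (Φ.injective.ne hpr) (fun P hP => adj_of_mem_clsOut hP)] at key
  conv_rhs at key => rw [sum_split_three (π := fun P => (finalDart P).1) (fun y => (edir (Φ v) y)⁻¹) hp' hq' hr'
      (Φ.injective.ne hpq) (Φ.injective.ne hqr) (Φ.injective.ne hpr) (fun P hP => adj_of_mem_clsIn hP)]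
  rw [← departureObservable_eq rfl hu hw₁ huw hΦu hΦw haff hα hp hv,
    ← departureObservable_eq rfl hu hw₁ huw hΦu hΦw haff hα hq hv,
    ← departureObservable_eq rfl hu hw₁ huw hΦu hΦw haff hα hr hv,
    ← firstArrivalObservable_eq rfl hu hw₁ huw hΦu hΦw haff hα hp hv,
    ← firstArrivalObservable_eq rfl hu hw₁ huw hΦu hΦw haff hα hq hv,
    ← firstArrivalObservable_eq rfl hu hw₁ huw hΦu hΦw haff hα hr hv,
    edir_chart haff, edir_chart haff, edir_chart haff] at key
  -- cancel the common factor `(2α)⁻¹`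
  have h2α : (2 : ℂ) * α ≠ 0 := mul_ne_zero two_ne_zero hα
  have hmp : hexMidpoint s(v, p) - hexCenter v ≠ 0 := by
    intro h0; apply edir_ne_zero hp'; rw [edir_chart haff, h0, mul_zero]
  have hmq : hexMidpoint s(v, q) - hexCenter v ≠ 0 := by
    intro h0; apply edir_ne_zero hq'; rw [edir_chart haff, h0, mul_zero]
  have hmr : hexMidpoint s(v, r) - hexCenter v ≠ 0 := by
    intro h0; apply edir_ne_zero hr'; rw [edir_chart haff, h0, mul_zero]
  have e : ∀ z : ℂ, z ≠ 0 → (2 * α * z)⁻¹ = (2 * α)⁻¹ * z⁻¹ := fun z _ => by rw [mul_inv]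
  rw [e _ hmp, e _ hmq, e _ hmr] at key
  have key' := congrArg (fun z => 2 * α * z) key
  simp only [mul_add] at key'
  simp only [mul_assoc] at key' ⊢
  rw [mul_left_comm] at key'
  linear_combination (norm := skip) key'
  simp only [mul_add, mul_left_comm α]
  field_simp
  ring

/-- **The observable's sum mode at a vertex** (`F = A + L + D`):
`F_p + F_q + F_r = (1 + x_c(λ + λ⁻¹)) (A_p + A_q + A_r) + (L_p + L_q + L_r)`, i.e. `1.8587… × ` the first
arrivals' sum mode plus the loop walks. [cite: DuminilCopinSmirnov2012, proof of Lemma 1] -/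
theorem observable_sum_eq (ha : a ∈ hexDomainBoundary Λ) (hv : v ∈ Λ) (hp : hexGraph.Adj v p)
    (hq : hexGraph.Adj v q) (hr : hexGraph.Adj v r) (hpq : p ≠ q) (hqr : q ≠ r) (hpr : p ≠ r) :
    hexParafermionicObservable Λ a hexCriticalFugacity (5 / 8) s(v, p) +
        hexParafermionicObservable Λ a hexCriticalFugacity (5 / 8) s(v, q) +
          hexParafermionicObservable Λ a hexCriticalFugacity (5 / 8) s(v, r) =
      (1 + (hexCriticalFugacity : ℂ) * (lam + lam ^ (-1 : ℤ))) *
          (firstArrivalObservable Λ a hexCriticalFugacity (5 / 8) v p +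
            firstArrivalObservable Λ a hexCriticalFugacity (5 / 8) v q +
              firstArrivalObservable Λ a hexCriticalFugacity (5 / 8) v r) +
        (loopArrivalObservable Λ a hexCriticalFugacity (5 / 8) v p +
          loopArrivalObservable Λ a hexCriticalFugacity (5 / 8) v q +
            loopArrivalObservable Λ a hexCriticalFugacity (5 / 8) v r) := by
  have key := departure_sum_eq ha hv hp hq hr hpq hqr hpr
  rw [hexParafermionicObservable_eq_parts, hexParafermionicObservable_eq_parts,
    hexParafermionicObservable_eq_parts]
  linear_combination key

/-- **The observable's Beltrami mode at a vertex** (`F = A + L + D`):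
`Σ_t (mid_t - v)⁻¹ F_t = (1 + x_c(λ⁻¹⁷ - λ⁻⁷)) Σ_t (mid_t - v)⁻¹ A_t + Σ_t (mid_t - v)⁻¹ L_t`, i.e. `1.1413… × `
the first arrivals' Beltrami mode plus the loop walks. With the direction weights `(mid_t - v)` themselves
the coefficient is `1 + x_c(ω²λ⁻¹ - ωλ) = 0` and the loop part vanishes in a simply connected domain
(Lemma 1). [cite: DuminilCopinSmirnov2012, proof of Lemma 1] -/
theorem observable_twist_eq (ha : a ∈ hexDomainBoundary Λ) (hv : v ∈ Λ) (hp : hexGraph.Adj v p)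
    (hq : hexGraph.Adj v q) (hr : hexGraph.Adj v r) (hpq : p ≠ q) (hqr : q ≠ r) (hpr : p ≠ r) :
    (hexMidpoint s(v, p) - hexCenter v)⁻¹ * hexParafermionicObservable Λ a hexCriticalFugacity (5 / 8) s(v, p) +
        (hexMidpoint s(v, q) - hexCenter v)⁻¹ *
            hexParafermionicObservable Λ a hexCriticalFugacity (5 / 8) s(v, q) +
          (hexMidpoint s(v, r) - hexCenter v)⁻¹ *
            hexParafermionicObservable Λ a hexCriticalFugacity (5 / 8) s(v, r) =
      (1 + (hexCriticalFugacity : ℂ) * (lam ^ (-17 : ℤ) - lam ^ (-7 : ℤ))) *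
          ((hexMidpoint s(v, p) - hexCenter v)⁻¹ * firstArrivalObservable Λ a hexCriticalFugacity (5 / 8) v p +
            (hexMidpoint s(v, q) - hexCenter v)⁻¹ * firstArrivalObservable Λ a hexCriticalFugacity (5 / 8) v q +
              (hexMidpoint s(v, r) - hexCenter v)⁻¹ *
                firstArrivalObservable Λ a hexCriticalFugacity (5 / 8) v r) +
        ((hexMidpoint s(v, p) - hexCenter v)⁻¹ * loopArrivalObservable Λ a hexCriticalFugacity (5 / 8) v p +
          (hexMidpoint s(v, q) - hexCenter v)⁻¹ * loopArrivalObservable Λ a hexCriticalFugacity (5 / 8) v q +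
            (hexMidpoint s(v, r) - hexCenter v)⁻¹ * loopArrivalObservable Λ a hexCriticalFugacity (5 / 8) v r) := by
  have key := departure_twist_eq ha hv hp hq hr hpq hqr hpr
  rw [hexParafermionicObservable_eq_parts, hexParafermionicObservable_eq_parts,
    hexParafermionicObservable_eq_parts]
  linear_combination key

/-! ### Real coefficients and the clockwise-frame form -/

/-- **Sum mode with the real coefficient**: `F₀ + F₁ + F₂ = (1 + 2x_c cos(5π/24))(A₀ + A₁ + A₂) + (L₀ + L₁ + L₂)`
(`1 + 2x_c cos(5π/24) = 1.8587…`). [cite: DuminilCopinSmirnov2012, proof of Lemma 1] -/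
theorem observable_sum_eq_real (ha : a ∈ hexDomainBoundary Λ) (hv : v ∈ Λ) (hp : hexGraph.Adj v p)
    (hq : hexGraph.Adj v q) (hr : hexGraph.Adj v r) (hpq : p ≠ q) (hqr : q ≠ r) (hpr : p ≠ r) :
    hexParafermionicObservable Λ a hexCriticalFugacity (5 / 8) s(v, p) +
        hexParafermionicObservable Λ a hexCriticalFugacity (5 / 8) s(v, q) +
          hexParafermionicObservable Λ a hexCriticalFugacity (5 / 8) s(v, r) =
      ((1 + 2 * hexCriticalFugacity * Real.cos (5 * Real.pi / 24) : ℝ) : ℂ) *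
          (firstArrivalObservable Λ a hexCriticalFugacity (5 / 8) v p +
            firstArrivalObservable Λ a hexCriticalFugacity (5 / 8) v q +
              firstArrivalObservable Λ a hexCriticalFugacity (5 / 8) v r) +
        (loopArrivalObservable Λ a hexCriticalFugacity (5 / 8) v p +
          loopArrivalObservable Λ a hexCriticalFugacity (5 / 8) v q +
            loopArrivalObservable Λ a hexCriticalFugacity (5 / 8) v r) := by
  have key := observable_sum_eq ha hv hp hq hr hpq hqr hpr
  rw [lam_add_lam_inv] at key
  push_cast at key ⊢
  linear_combination key

/-- The inverse of a rotated half-direction: `(ζᵏ d / 2)⁻¹ = 2 d⁻¹ ζˡ` for `k + l = 6`. [folklore] -/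
theorem inv_rot_half {d : ℂ} (hd : d ≠ 0) (k l : ℕ) (hkl : k + l = 6) :
    (triZeta ^ k * d / 2)⁻¹ = 2 * d⁻¹ * triZeta ^ l := by
  refine inv_eq_of_mul_eq_one_right ?_
  rw [show triZeta ^ k * d / 2 * (2 * d⁻¹ * triZeta ^ l) = triZeta ^ (k + l) * (d * d⁻¹) by rw [pow_add]; ring,
    mul_inv_cancel₀ hd, hkl, triZeta_pow_six, one_mul]

/-- **Beltrami mode in a clockwise frame.** For a CLOCKWISE labelling `w₀, w₁, w₂` of the neighbours of
`v ∈ Λ` (`c w₁ - c v = ζ⁴ (c w₀ - c v)`, `c w₂ - c v = ζ² (c w₀ - c v)`, `ζ = e^{iπ/3}`, so `ω = ζ²`) and a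
boundary mid-edge `a`, at `x = x_c`, `σ = 5/8`:
`F₀ + ωF₁ + ω²F₂ = (1 + 2x_c cos(11π/24))·(A₀ + ωA₁ + ω²A₂) + (L₀ + ωL₁ + ω²L₂)` (`1 + 2x_c cos(11π/24) = 1.1413…`).
Together with `observable_sum_eq_real`: the Beltrami quotient `‖F₀ + ωF₁ + ω²F₂‖ / ‖F₀ + F₁ + F₂‖` at `v` equals
`‖1.1413·B_A + B_L‖ / ‖1.8587·M_A + M_L‖` with `B_A, M_A` the same two combinations of the FIRST ARRIVALS and
`B_L, M_L` those of the loop walks; for a single first-arrival class it is `0.6140…`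
(`HV.singleton_quotient_pos_lt_one`). In a counter-clockwise frame the left side is `0` (Lemma 1).
[cite: DuminilCopinSmirnov2012, proof of Lemma 1] -/
theorem observable_cw_beltrami_eq {w₀ w₁ w₂ : HexVertex} (ha : a ∈ hexDomainBoundary Λ) (hv : v ∈ Λ)
    (h₀ : hexGraph.Adj v w₀) (h₁ : hexGraph.Adj v w₁) (h₂ : hexGraph.Adj v w₂) (h01 : w₀ ≠ w₁) (h12 : w₁ ≠ w₂)
    (h02 : w₀ ≠ w₂) (hd₁ : hexCenter w₁ - hexCenter v = triZeta ^ 4 * (hexCenter w₀ - hexCenter v))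
    (hd₂ : hexCenter w₂ - hexCenter v = triZeta ^ 2 * (hexCenter w₀ - hexCenter v)) :
    hexParafermionicObservable Λ a hexCriticalFugacity (5 / 8) s(v, w₀) +
        triZeta ^ 2 * hexParafermionicObservable Λ a hexCriticalFugacity (5 / 8) s(v, w₁) +
          triZeta ^ 4 * hexParafermionicObservable Λ a hexCriticalFugacity (5 / 8) s(v, w₂) =
      ((1 + 2 * hexCriticalFugacity * Real.cos (11 * Real.pi / 24) : ℝ) : ℂ) *
          (firstArrivalObservable Λ a hexCriticalFugacity (5 / 8) v w₀ +
            triZeta ^ 2 * firstArrivalObservable Λ a hexCriticalFugacity (5 / 8) v w₁ +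
              triZeta ^ 4 * firstArrivalObservable Λ a hexCriticalFugacity (5 / 8) v w₂) +
        (loopArrivalObservable Λ a hexCriticalFugacity (5 / 8) v w₀ +
          triZeta ^ 2 * loopArrivalObservable Λ a hexCriticalFugacity (5 / 8) v w₁ +
            triZeta ^ 4 * loopArrivalObservable Λ a hexCriticalFugacity (5 / 8) v w₂) := by
  have key := observable_twist_eq ha hv h₀ h₁ h₂ h01 h12 h02
  have hm : ∀ w, hexMidpoint s(v, w) - hexCenter v = (hexCenter w - hexCenter v) / 2 := fun w => by
    rw [hexMidpoint_mk]; ring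
  set d := hexCenter w₀ - hexCenter v with hd_def
  have hd : d ≠ 0 := sub_ne_zero.2 (hexCenter_ne_of_adj h₀).symm
  have i0 : (d / 2)⁻¹ = 2 * d⁻¹ := by
    have := inv_rot_half hd 0 6 rfl
    rwa [pow_zero, one_mul, triZeta_pow_six, mul_one] at this
  rw [hm, hm, hm, hd₁, hd₂, i0, inv_rot_half hd 4 2 rfl, inv_rot_half hd 2 4 rfl, lam_B] at key
  have key' := congrArg (fun z => d / 2 * z) key
  simp only [mul_add] at key'
  have c1 : ∀ z : ℂ, d / 2 * (2 * d⁻¹ * z) = z := fun z => by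
    rw [show d / 2 * (2 * d⁻¹ * z) = d * d⁻¹ * z by ring, mul_inv_cancel₀ hd, one_mul]
  have c2 : ∀ z e : ℂ, d / 2 * (2 * d⁻¹ * e * z) = e * z := fun z e => by
    rw [show d / 2 * (2 * d⁻¹ * e * z) = d * d⁻¹ * (e * z) by ring, mul_inv_cancel₀ hd, one_mul]
  have c3 : ∀ z e κ : ℂ, d / 2 * (κ * (2 * d⁻¹ * e * z)) = κ * (e * z) := fun z e κ => by
    rw [show d / 2 * (κ * (2 * d⁻¹ * e * z)) = d * d⁻¹ * (κ * (e * z)) by ring, mul_inv_cancel₀ hd, one_mul]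
  have c4 : ∀ z κ : ℂ, d / 2 * (κ * (2 * d⁻¹ * z)) = κ * z := fun z κ => by
    rw [show d / 2 * (κ * (2 * d⁻¹ * z)) = d * d⁻¹ * (κ * z) by ring, mul_inv_cancel₀ hd, one_mul]
  simp only [c1, c2, c3, c4] at key'
  push_cast at key' ⊢
  linear_combination key'

end Modes

end Literature.Probability.RandomPlanarGeometry.SAW

end
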